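import Mathlib
import Summits.NavierStokesRegularity.NavierStokesRegularity.Theorems.SubOnsagerCeilingDefs
import Summits.NavierStokesRegularity.NavierStokesRegularity.Theorems.SubOnsagerCeilingGapChain10
import Summits.NavierStokesRegularity.NavierStokesRegularity.Theorems.OrthantWakeDyadicBreakBelowOneOfShellBarrier
import HarnessLib

/-!
# Route SubOnsagerCeiling — the one-mode item `DyadicTailCeiling` (stmt-NavierStokesRegularity-25511) BY NAME:
# proved at every scale ratio `1+ε₀ ∈ [34/25, 2]`, and reduced to its small-ratio half
# (helper file, def-free; `--supports` the crux `ForwardTailCeilingKP`, stmt-NavierStokesRegularity-27057)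

The route's banked aside `Theses.SubOnsagerCeiling.DyadicTailCeiling` (item 25511, «never staffed») is the
one-mode member of the crux `ForwardTailCeilingKP`: for every scale ratio `1+ε₀ ∈ (1,2]` a sub-Onsager
(`θ > 1/2`) weighted tail ceiling, uniform in the viscosity `ν > 0`, for the non-negative honest viscous
solutions of the scalar Katz–Pavlović lattice `dyadicTable` from a one-shell datum.  It is exactly the
«chain corner» contained in BOTH registered stubs `stub_primaryGradedLargeRatio` /
`stub_primaryGradedSmallRatio` of the LEAD skeleton `Cruxes/ForwardTailCeilingKP/Lines/kp_shell_barrier.lean`,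
and no Theorems file mentioned it so far.  This file records its status BY NAME from the landed chain rungs:

* `dyadicTailCeilingAt_of_shellBarrierAt` — at one ratio: a shell barrier for every scaled dyadic table
  (the exact shape `∀ α, IsScaledDyadic α → ShellBarrierAt 2 ε₀ α` of the LEAD's rungs) gives the body of
  `DyadicTailCeiling` at `ε₀` (table-class input `inTableClass_dyadicTable`, orthant input
  `dyadicSocket_kamke`, then the geometric series `Σ_{k=n}^{N} r^k ≤ r^n/(1-r)`, `r = (1+ε₀)^{-2θ} < 1`,
  with `C = 4D/(1-r)`);
* **`dyadicTailCeilingAt_largeRatio`** — the body of `DyadicTailCeiling` at EVERY `ε₀ ∈ [9/25, 1]`, i.e. at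
  every scale ratio `b ∈ [1.36, 2]`, from `dyadicGapRange10Wide_shellBarrierAt` (LEAD soc-p2 g3–g12: BMR
  two-window region on `[1.7,2]`, one-cut three-window templates on `[1.5625,1.7]`, Ω-coupled four-window
  kernel certificates d45/d147θ/d145θ/d144θ and the 13-face spec-list designs dH…dO down to `34/25`);
* **`dyadicTailCeiling_of_smallRatio`** — WHAT IS LEFT of item 25511, by name: `DyadicTailCeiling` follows from
  its small-ratio half `ε₀ ∈ (0, 9/25)` alone (scale ratios `b ∈ (1, 1.36)`: the window where the LEAD's
  four-window polynomial certificates end, census v15 §M.10, and — as `b ↓ 1` — where the certificate window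
  count diverges, so that an analytic near-continuum theorem is required; numerically the front exponent is
  Kolmogorov (`θ = 5/6`, `D = 1`) for `b ≤ 1.03` and `b ≥ 1.29` and dips to `≈ 0.60 > 1/2` near `b ≈ 1.10`,
  hands leafhand-4 g0/g2/g3).

HONEST FRAMING: bookkeeping on a MODEL lattice ODE (route SubOnsagerCeiling, rung TL-M2Break): two corollaries
of landed theorems and one reduction between statements; item 25511 stays OPEN (its small-ratio half is
≥ open in print: the λ-uniform Barbato–Morandin–Romito / Cheskidov–Zaya region is in print at ratio 2 only);
no stub, crux or summit is proved here and nothing in this file bears on Navier–Stokes regularity.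
[cite: BarbatoMorandinRomito2011, §2 Lemma 2.1 and §3.2]; [cite: Tao2016AveragedNS, §4 (4.2)–(4.3), (4.5), (4.8)].
-/

noncomputable section

-- the sub-problem namespace `NavierStokesRegularity.NavierStokesRegularity` is the tree's layout (D-0017)
set_option linter.dupNamespace false

namespace Summit.NavierStokesRegularity.NavierStokesRegularity.Theorems

open Set
open Literature.Analysis.FluidPDE.TaoCascade
open Summit.NavierStokesRegularity.NavierStokesRegularity.Theses.SubOnsagerCeiling
open Summit.NavierStokesRegularity.NavierStokesRegularity.Theorems.SubOnsagerCeiling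

/-- **Geometric summation of a shell barrier** (the arithmetic of «barrier ⇒ tail ceiling»): if `b > 1`,
`θ > 0` and the four components of a shell sequence obey `b^{2θk}·½X_{i,k}² ≤ D·E₀` for every shell `k`, then
every partial tail `Σ_{k=n}^{N} Σ_i ½X_{i,k}²` is at most `(4D/(1-r))·E₀·b^{-2θn}` with `r = b^{-2θ}`.
Pure real analysis on one time slice (copied in substance from the registered predecessor skeletons
`Cruxes/OrthantTailCeiling/Lines/shell_barrier.lean`, `Cruxes/ForwardTailCeilingKP/Lines/kp_shell_barrier.lean`,
which are not importable). [folklore] -/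
theorem tailSum_le_of_shellBarrier {b θ D E₀ : ℝ} (hb : 1 < b) (hθ : 0 < θ) (hD : 0 ≤ D) (hE₀ : 0 ≤ E₀)
    {Z : Fin 4 → ℕ → ℝ}
    (h : ∀ (i : Fin 4) (k : ℕ), b ^ (2 * θ * (k : ℝ)) * ((1 / 2 : ℝ) * Z i k ^ 2) ≤ D * E₀)
    {n N : ℕ} :
    ∑ k ∈ Finset.Icc n N, ∑ i : Fin 4, (1 / 2 : ℝ) * Z i k ^ 2 ≤
      4 * D / (1 - b ^ (-(2 * θ))) * E₀ * b ^ (-(2 * θ * (n : ℝ))) := by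
  have hb0 : (0 : ℝ) ≤ b := by linarith
  have hb0' : (0 : ℝ) < b := by linarith
  set r : ℝ := b ^ (-(2 * θ)) with hr_def
  have hr0 : 0 < r := Real.rpow_pos_of_pos hb0' _
  have hr1 : r < 1 := by
    have : b ^ (-(2 * θ)) < b ^ (0 : ℝ) :=
      Real.rpow_lt_rpow_of_exponent_lt hb (by linarith)
    simpa [hr_def] using this
  have h1r : 0 < 1 - r := by linarith
  have hpow : ∀ k : ℕ, b ^ (2 * θ * (k : ℝ)) * r ^ k = 1 := by
    intro k
    rw [hr_def, ← Real.rpow_mul_natCast hb0, ← Real.rpow_add hb0']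
    have : 2 * θ * (k : ℝ) + -(2 * θ) * (k : ℝ) = 0 := by ring
    rw [this, Real.rpow_zero]
  have hshell : ∀ k : ℕ, ∑ i : Fin 4, (1 / 2 : ℝ) * Z i k ^ 2 ≤ 4 * D * E₀ * r ^ k := by
    intro k
    have hk : ∀ i : Fin 4, (1 / 2 : ℝ) * Z i k ^ 2 ≤ D * E₀ * r ^ k := by
      intro i
      have hrk : 0 < r ^ k := pow_pos hr0 k
      have := mul_le_mul_of_nonneg_right (h i k) hrk.le
      calc (1 / 2 : ℝ) * Z i k ^ 2
          = (b ^ (2 * θ * (k : ℝ)) * r ^ k) * ((1 / 2 : ℝ) * Z i k ^ 2) := by rw [hpow k, one_mul]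
        _ = b ^ (2 * θ * (k : ℝ)) * ((1 / 2 : ℝ) * Z i k ^ 2) * r ^ k := by ring
        _ ≤ D * E₀ * r ^ k := this
    calc ∑ i : Fin 4, (1 / 2 : ℝ) * Z i k ^ 2
        ≤ ∑ _i : Fin 4, D * E₀ * r ^ k := Finset.sum_le_sum fun i _ => hk i
      _ = 4 * D * E₀ * r ^ k := by simp [Finset.sum_const, Finset.card_univ, Fintype.card_fin]; ring
  have hgeom : ∑ k ∈ Finset.Icc n N, r ^ k ≤ r ^ n / (1 - r) := by
    rw [← Finset.Ico_add_one_right_eq_Icc]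
    exact geom_sum_Ico_le_of_lt_one hr0.le hr1
  have hrn : r ^ n = b ^ (-(2 * θ * (n : ℝ))) := by
    rw [hr_def, ← Real.rpow_mul_natCast hb0]
    congr 1; ring
  have hDE : 0 ≤ 4 * D * E₀ := by positivity
  calc ∑ k ∈ Finset.Icc n N, ∑ i : Fin 4, (1 / 2 : ℝ) * Z i k ^ 2
      ≤ ∑ k ∈ Finset.Icc n N, 4 * D * E₀ * r ^ k := Finset.sum_le_sum fun k _ => hshell k
    _ = 4 * D * E₀ * ∑ k ∈ Finset.Icc n N, r ^ k := by rw [Finset.mul_sum (s := Finset.Icc n N)]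
    _ ≤ 4 * D * E₀ * (r ^ n / (1 - r)) := mul_le_mul_of_nonneg_left hgeom hDE
    _ = 4 * D / (1 - r) * E₀ * b ^ (-(2 * θ * (n : ℝ))) := by rw [← hrn]; field_simp

/-- **At one ratio: shell barrier for every scaled dyadic table ⇒ the body of `DyadicTailCeiling`.**  The
hypothesis is the exact shape `∀ α, IsScaledDyadic α → ShellBarrierAt 2 ε₀ α` in which the LEAD's chain rungs
land (`dyadicRange_shellBarrierAt`, …, `dyadicGapRange10Wide_shellBarrierAt`); the conclusion is the body of
the route item `DyadicTailCeiling` (stmt-25511) at the ratio `1+ε₀`, verbatim.  Inputs: `dyadicTable ∈ E₂(2)`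
(`inTableClass_dyadicTable`), its orthant (Kamke) property (`dyadicSocket_kamke`), `dyadicTable` is scaled
dyadic with `c = 1` (`isScaledDyadic_dyadicTable`), and the geometric series `tailSum_le_of_shellBarrier`.
MODEL lattice statement. [this file] -/
theorem dyadicTailCeilingAt_of_shellBarrierAt {ε₀ : ℝ} (hε : 0 < ε₀)
    (h : ∀ α : Fin 4 → Fin 4 → Fin 4 → ℤ × ℤ × ℤ → ℝ, IsScaledDyadic α → ShellBarrierAt 2 ε₀ α) :
    ∃ θ : ℝ, 1 / 2 < θ ∧ ∃ C : ℝ, 0 ≤ C ∧ ∀ ν : ℝ, 0 < ν → ∀ (X₀ : Fin 4 → ℝ) (s : ℝ), 0 < s →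
      ∀ X : Fin 4 → ℤ → ℝ → ℝ, (∀ (i : Fin 4) (k : ℤ), X i k 0 = if k = 0 then X₀ i else 0) →
      (∀ (i : Fin 4) (k : ℤ), k < 0 → ∀ t : ℝ, X i k t = 0) →
      (∃ M : ℝ, ∀ (t : ℝ) (i : Fin 4) (k : ℤ), (1 + (1 + ε₀) ^ ((10 : ℝ) * k)) * |X i k t| ≤ M) →
      (∀ (i : Fin 4) (k : ℤ), Continuous (X i k)) →
      (∀ (i : Fin 4) (k : ℤ), ∀ t ∈ Set.Icc (0 : ℝ) s, HasDerivWithinAt (X i k)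
        (Literature.Analysis.FluidPDE.TaoCascade.quadTerm ε₀ Literature.Analysis.FluidPDE.TaoCascade.dyadicTable X i k t
          - ν * (1 + ε₀) ^ ((2 : ℝ) * k) * X i k t) (Set.Icc (0 : ℝ) s) t) →
      (∀ t ∈ Set.Icc (0 : ℝ) s, ∀ (i : Fin 4) (k : ℤ), 1 ≤ k → 0 ≤ X i k t) →
      ∀ n N : ℕ, n ≤ N → ∀ t ∈ Set.Icc (0 : ℝ) s,
        ∑ k ∈ Finset.Icc n N, ∑ i : Fin 4, (1 / 2 : ℝ) * X i (k : ℤ) t ^ 2 ≤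
          C * (∑ i : Fin 4, (1 / 2 : ℝ) * X₀ i ^ 2) * (1 + ε₀) ^ (-(2 * θ * (n : ℝ))) := by
  obtain ⟨θ, hθ, D, hD, hbar⟩ :=
    h dyadicTable isScaledDyadic_dyadicTable (inTableClass_dyadicTable le_rfl) dyadicSocket_kamke
  have hb : (1 : ℝ) < 1 + ε₀ := by linarith
  have hθ0 : 0 < θ := by linarith
  have hr1 : (1 + ε₀) ^ (-(2 * θ)) < 1 := by
    have : (1 + ε₀) ^ (-(2 * θ)) < (1 + ε₀) ^ (0 : ℝ) :=
      Real.rpow_lt_rpow_of_exponent_lt hb (by linarith)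
    simpa using this
  refine ⟨θ, hθ, 4 * D / (1 - (1 + ε₀) ^ (-(2 * θ))), by
    have : 0 < 1 - (1 + ε₀) ^ (-(2 * θ)) := by linarith
    positivity, ?_⟩
  intro ν hν X₀ s hs X hdat hvan hbdd hcont hode hnn n N _hnN t ht
  have hE₀ : 0 ≤ ∑ j : Fin 4, (1 / 2 : ℝ) * X₀ j ^ 2 := Finset.sum_nonneg fun j _ => by positivity
  have hB := hbar ν hν X₀ s hs X hdat hvan hbdd hcont hode hnn t ht
  exact tailSum_le_of_shellBarrier (Z := fun i k => X i (k : ℤ) t) hb hθ0 hD hE₀ (fun i k => hB i k)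

/-- **`DyadicTailCeiling` (item stmt-25511) holds at EVERY scale ratio `1+ε₀ ∈ [34/25, 2]`** — the body of
the route decl at every `ε₀ ∈ [9/25, 1]`, from the LEAD's chain rungs glued down to `b = 1.36`
(`dyadicGapRange10Wide_shellBarrierAt`: `θ = 101/200`, `D = 100` on every slice, uniformly in `ν > 0`).
What remains of the item is `ε₀ ∈ (0, 9/25)` (`dyadicTailCeiling_of_smallRatio`). MODEL lattice statement.
[cite: BarbatoMorandinRomito2011, §2 Lemma 2.1 and §3.2] -/
theorem dyadicTailCeilingAt_largeRatio : ∀ ε₀ : ℝ, (9 : ℝ) / 25 ≤ ε₀ → ε₀ ≤ 1 →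
    ∃ θ : ℝ, 1 / 2 < θ ∧ ∃ C : ℝ, 0 ≤ C ∧ ∀ ν : ℝ, 0 < ν → ∀ (X₀ : Fin 4 → ℝ) (s : ℝ), 0 < s →
      ∀ X : Fin 4 → ℤ → ℝ → ℝ, (∀ (i : Fin 4) (k : ℤ), X i k 0 = if k = 0 then X₀ i else 0) →
      (∀ (i : Fin 4) (k : ℤ), k < 0 → ∀ t : ℝ, X i k t = 0) →
      (∃ M : ℝ, ∀ (t : ℝ) (i : Fin 4) (k : ℤ), (1 + (1 + ε₀) ^ ((10 : ℝ) * k)) * |X i k t| ≤ M) →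
      (∀ (i : Fin 4) (k : ℤ), Continuous (X i k)) →
      (∀ (i : Fin 4) (k : ℤ), ∀ t ∈ Set.Icc (0 : ℝ) s, HasDerivWithinAt (X i k)
        (Literature.Analysis.FluidPDE.TaoCascade.quadTerm ε₀ Literature.Analysis.FluidPDE.TaoCascade.dyadicTable X i k t
          - ν * (1 + ε₀) ^ ((2 : ℝ) * k) * X i k t) (Set.Icc (0 : ℝ) s) t) →
      (∀ t ∈ Set.Icc (0 : ℝ) s, ∀ (i : Fin 4) (k : ℤ), 1 ≤ k → 0 ≤ X i k t) →
      ∀ n N : ℕ, n ≤ N → ∀ t ∈ Set.Icc (0 : ℝ) s,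
        ∑ k ∈ Finset.Icc n N, ∑ i : Fin 4, (1 / 2 : ℝ) * X i (k : ℤ) t ^ 2 ≤
          C * (∑ i : Fin 4, (1 / 2 : ℝ) * X₀ i ^ 2) * (1 + ε₀) ^ (-(2 * θ * (n : ℝ))) := by
  intro ε₀ hε hε1
  exact dyadicTailCeilingAt_of_shellBarrierAt (by linarith)
    (fun α hα => dyadicGapRange10Wide_shellBarrierAt 2 ε₀ hε hε1 α hα)

/-- **What is left of item stmt-25511, by name: `DyadicTailCeiling` follows from its SMALL-RATIO half.**  If the
body of `DyadicTailCeiling` holds at every `ε₀ ∈ (0, 9/25)` — scale ratios `b ∈ (1, 1.36)`, the window not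
reached by the landed certificates (and, as `b ↓ 1`, not reachable by finitely many certificate slices) —
then `DyadicTailCeiling` holds, the range `ε₀ ∈ [9/25, 1]` being `dyadicTailCeilingAt_largeRatio`.
A reduction between statements; MODEL lattice only. [this file] -/
theorem dyadicTailCeiling_of_smallRatio
    (h : ∀ ε₀ : ℝ, 0 < ε₀ → ε₀ < (9 : ℝ) / 25 →
      ∃ θ : ℝ, 1 / 2 < θ ∧ ∃ C : ℝ, 0 ≤ C ∧ ∀ ν : ℝ, 0 < ν → ∀ (X₀ : Fin 4 → ℝ) (s : ℝ), 0 < s →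
      ∀ X : Fin 4 → ℤ → ℝ → ℝ, (∀ (i : Fin 4) (k : ℤ), X i k 0 = if k = 0 then X₀ i else 0) →
      (∀ (i : Fin 4) (k : ℤ), k < 0 → ∀ t : ℝ, X i k t = 0) →
      (∃ M : ℝ, ∀ (t : ℝ) (i : Fin 4) (k : ℤ), (1 + (1 + ε₀) ^ ((10 : ℝ) * k)) * |X i k t| ≤ M) →
      (∀ (i : Fin 4) (k : ℤ), Continuous (X i k)) →
      (∀ (i : Fin 4) (k : ℤ), ∀ t ∈ Set.Icc (0 : ℝ) s, HasDerivWithinAt (X i k)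
        (Literature.Analysis.FluidPDE.TaoCascade.quadTerm ε₀ Literature.Analysis.FluidPDE.TaoCascade.dyadicTable X i k t
          - ν * (1 + ε₀) ^ ((2 : ℝ) * k) * X i k t) (Set.Icc (0 : ℝ) s) t) →
      (∀ t ∈ Set.Icc (0 : ℝ) s, ∀ (i : Fin 4) (k : ℤ), 1 ≤ k → 0 ≤ X i k t) →
      ∀ n N : ℕ, n ≤ N → ∀ t ∈ Set.Icc (0 : ℝ) s,
        ∑ k ∈ Finset.Icc n N, ∑ i : Fin 4, (1 / 2 : ℝ) * X i (k : ℤ) t ^ 2 ≤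
          C * (∑ i : Fin 4, (1 / 2 : ℝ) * X₀ i ^ 2) * (1 + ε₀) ^ (-(2 * θ * (n : ℝ)))) :
    DyadicTailCeiling := by
  intro ε₀ h0 hle
  rcases lt_or_ge ε₀ ((9 : ℝ) / 25) with hlt | hge
  · exact h ε₀ h0 hlt
  · exact dyadicTailCeilingAt_largeRatio ε₀ hge hle

end Summit.NavierStokesRegularity.NavierStokesRegularity.Theorems

end
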